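import Summits.NavierStokesRegularity.NavierStokesRegularity.Theorems.SwirlFreeBudgetMoserAbsorb
import Summits.NavierStokesRegularity.NavierStokesRegularity.Theorems.SwirlFreeBudgetMoserChain
import Literature.Analysis.FluidPDE.LocalTypeIReverseTools
import HarnessLib

/-!
# SwirlFreeBudget, toward crux K-18.1 `EtaMoserBound` (T-18.2): the `L^p → L^∞` Moser bound with a
# start exponent `p < 2` on parabolic cylinders (memo A.5–A.7 combined), generic (seat nsreg-p4 g12)

Support file for the DORMANT route `SwirlThreshold` (crux stmt-NavierStokesRegularity-2002) and
planner nsreg-p2's ROUND-18 Appendix A (`R18-APPENDIX-EtaMoser.md`).  Combines the two generic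
bricks `eLpNorm_top_le_of_reverseHolder_parabolicCylinder` (A.5 ⇒ A.6, Moser's chain) and
`moser_absorb_pLtTwo` (A.6 ⇒ A.7, the `p < 2` absorption) into the statement the η-Moser lemma
consumes: for an essentially bounded `g` on `Q(z₁, R₂)` satisfying the reverse Hölder inequalities
`‖g‖_{L^{10m/3}(Q(z₁,ϱ))} ≤ (N₁ϱ'/(ϱ'-ϱ)²)^{1/m} ‖g‖_{L^{2m}(Q(z₁,ϱ'))}` (`m ≥ 1`,
`R₂/2 ≤ ϱ < ϱ' ≤ R₂`) and any `0 < p < 2`,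
`‖g‖_{L^∞(Q(z₁,R₂/2))} ≤ c_p K₀^{2/p} (∫∫_{Q(z₁,R₂)} |g|^p)^{1/p} (R₂/2)^{-10/p}`,
`K₀ = (16 N₁² R₂²)^{5/4} 16^{15/8}` (`eLpNorm_top_half_le_of_reverseHolder_pStart`); the a-priori
bound enters only qualitatively (it disappears in the absorption).

* `eLpNorm_two_le_top_rpow_mul_lintegral` — the interpolation
  `‖g‖_{L²} ≤ ‖g‖_{L^∞}^{1-p/2} (∫ |g|^p)^{1/2}` (`0 < p < 2`).

WHAT THIS IS NOT: not NS regularity — measure-theoretic bookkeeping (the reverse Hölder step for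
`η = ω_θ/r` and `EtaMoserBound` itself stay OPEN); no crux claim.
-/

namespace Summit.NavierStokesRegularity.NavierStokesRegularity.Theorems.SwirlFreeBudget

open MeasureTheory Set Filter Topology Metric Function
open scoped ENNReal NNReal
open Literature.Analysis Literature.Analysis.FluidPDE

noncomputable section

/-- **Interpolation `L² ≤ (L^∞)^{1-p/2} (L^p)^{p/2}`**: for `0 < p < 2` and any measure,
`‖g‖_{L²(μ)} ≤ ‖g‖_{L^∞(μ)}^{1 - p/2} · (∫⁻ ‖g‖ₑ^p dμ)^{1/2}`. -/
theorem eLpNorm_two_le_top_rpow_mul_lintegral {α : Type*} [MeasurableSpace α] {μ : Measure α}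
    {g : α → ℝ} (hg : AEStronglyMeasurable g μ) {p : ℝ} (hp0 : 0 < p) (hp2 : p < 2) :
    eLpNorm g 2 μ ≤ eLpNorm g ∞ μ ^ (1 - p / 2) * (∫⁻ x, ‖g x‖ₑ ^ p ∂μ) ^ (1 / 2 : ℝ) := by
  set M := eLpNorm g ∞ μ with hM
  have h2 : eLpNorm g 2 μ = (∫⁻ x, ‖g x‖ₑ ^ (2 : ℝ) ∂μ) ^ (1 / 2 : ℝ) := by
    rw [eLpNorm_eq_lintegral_rpow_enorm_toReal two_ne_zero ENNReal.ofNat_ne_top]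
    norm_num
  have hae : ∀ᵐ x ∂μ, ‖g x‖ₑ ^ (2 : ℝ) ≤ M ^ (2 - p) * ‖g x‖ₑ ^ p := by
    filter_upwards [ae_le_eLpNormEssSup (μ := μ) (f := g)] with x hx
    rw [← eLpNorm_exponent_top] at hx
    have e : ‖g x‖ₑ ^ (2 : ℝ) = ‖g x‖ₑ ^ (2 - p) * ‖g x‖ₑ ^ p := by
      rw [← ENNReal.rpow_add_of_nonneg _ _ (by linarith) hp0.le]; congr 1; ring
    rw [e]
    gcongr
  have hmeas : AEMeasurable (fun x => ‖g x‖ₑ ^ p) μ := hg.enorm.pow_const p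
  calc eLpNorm g 2 μ = (∫⁻ x, ‖g x‖ₑ ^ (2 : ℝ) ∂μ) ^ (1 / 2 : ℝ) := h2
    _ ≤ (∫⁻ x, M ^ (2 - p) * ‖g x‖ₑ ^ p ∂μ) ^ (1 / 2 : ℝ) :=
        ENNReal.rpow_le_rpow (lintegral_mono_ae hae) (by norm_num)
    _ = (M ^ (2 - p) * ∫⁻ x, ‖g x‖ₑ ^ p ∂μ) ^ (1 / 2 : ℝ) := by rw [lintegral_const_mul'' _ hmeas]
    _ = M ^ (1 - p / 2) * (∫⁻ x, ‖g x‖ₑ ^ p ∂μ) ^ (1 / 2 : ℝ) := by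
        rw [ENNReal.mul_rpow_of_nonneg _ _ (by norm_num), ← ENNReal.rpow_mul]
        congr 2; ring

/-- **Moser's `L^p → L^∞` bound with start exponent `p < 2` on parabolic cylinders (memo R18
Appendix A.5–A.7), generic.**  For `0 < p < 2` there is `c = c(p) > 0` such that: if `g` is
essentially bounded on `Q(z₁, R₂)` (`R₂ > 0`) and satisfies, for some `N₁ > 0`, the reverse Hölder
inequalities `‖g‖_{L^{10m/3}(Q(z₁,ϱ))} ≤ (N₁ ϱ'/(ϱ'-ϱ)²)^{1/m} ‖g‖_{L^{2m}(Q(z₁,ϱ'))}` for all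
`m ≥ 1`, `R₂/2 ≤ ϱ < ϱ' ≤ R₂`, then
`‖g‖_{L^∞(Q(z₁,R₂/2))} ≤ c · K₀^{2/p} · (∫∫_{Q(z₁,R₂)} |g|^p)^{1/p} / (R₂/2)^{10/p}`,
`K₀ = (16 N₁² R₂²)^{5/4} 16^{15/8}`. -/
theorem eLpNorm_top_half_le_of_reverseHolder_pStart {p : ℝ} (hp0 : 0 < p) (hp2 : p < 2) :
    ∃ c : ℝ, 0 < c ∧ ∀ (g : ℝ × EuclideanSpace ℝ (Fin 3) → ℝ) (z₁ : ℝ × EuclideanSpace ℝ (Fin 3))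
      (R₂ N₁ : ℝ), 0 < R₂ → 0 < N₁ →
      AEStronglyMeasurable g (volume.restrict (parabolicCylinder R₂ z₁)) →
      eLpNorm g ∞ (volume.restrict (parabolicCylinder R₂ z₁)) < ∞ →
      (∀ m : ℝ, 1 ≤ m → ∀ ϱ ϱ' : ℝ, R₂ / 2 ≤ ϱ → ϱ < ϱ' → ϱ' ≤ R₂ →
        eLpNorm g (ENNReal.ofReal (10 * m / 3)) (volume.restrict (parabolicCylinder ϱ z₁)) ≤
          ENNReal.ofReal (N₁ * ϱ' / (ϱ' - ϱ) ^ 2) ^ (1 / m) *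
            eLpNorm g (ENNReal.ofReal (2 * m)) (volume.restrict (parabolicCylinder ϱ' z₁))) →
      (eLpNorm g ∞ (volume.restrict (parabolicCylinder (R₂ / 2) z₁))).toReal ≤
        c * ((16 * N₁ ^ 2 * R₂ ^ 2) ^ (5 / 4 : ℝ) * 16 ^ (15 / 8 : ℝ)) ^ (2 / p) *
          (∫⁻ w in parabolicCylinder R₂ z₁, ‖g w‖ₑ ^ p).toReal ^ (1 / p) / (R₂ / 2) ^ (10 / p) := by
  obtain ⟨c, hc, habs⟩ := moser_absorb_pLtTwo hp0 hp2 (α := 5) (by norm_num)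
  refine ⟨c, hc, ?_⟩
  intro g z₁ R₂ N₁ hR₂ hN₁ hg hbdd H
  -- notation
  set M : ℝ → ℝ≥0∞ := fun ρ => eLpNorm g ∞ (volume.restrict (parabolicCylinder ρ z₁)) with hMdef
  set f : ℝ → ℝ := fun ρ => (M ρ).toReal with hfdef
  set Ip : ℝ≥0∞ := ∫⁻ w in parabolicCylinder R₂ z₁, ‖g w‖ₑ ^ p with hIp
  set K₀ : ℝ := (16 * N₁ ^ 2 * R₂ ^ 2) ^ (5 / 4 : ℝ) * 16 ^ (15 / 8 : ℝ) with hK₀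
  have hK₀pos : 0 < K₀ := by positivity
  -- monotonicity and finiteness of `M`
  have hMmono : ∀ ρ ρ' : ℝ, 0 ≤ ρ → ρ ≤ ρ' → M ρ ≤ M ρ' := fun ρ ρ' h0 h =>
    eLpNorm_mono_measure g (Measure.restrict_mono (parabolicCylinder_subset_of_le h0 h z₁) le_rfl)
  have hMfin : ∀ ρ : ℝ, 0 ≤ ρ → ρ ≤ R₂ → M ρ < ∞ := fun ρ h0 h => (hMmono ρ R₂ h0 h).trans_lt hbdd
  -- finiteness of the start integral
  have hIp_fin : Ip < ∞ := by
    have hae : ∀ᵐ w ∂(volume.restrict (parabolicCylinder R₂ z₁)), ‖g w‖ₑ ^ p ≤ M R₂ ^ p := by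
      filter_upwards [ae_le_eLpNormEssSup (μ := volume.restrict (parabolicCylinder R₂ z₁)) (f := g)]
        with w hw
      rw [← eLpNorm_exponent_top] at hw
      exact ENNReal.rpow_le_rpow hw hp0.le
    refine (lintegral_mono_ae hae).trans_lt ?_
    rw [setLIntegral_const]
    exact ENNReal.mul_lt_top (ENNReal.rpow_lt_top_of_nonneg hp0.le hbdd.ne)
      (volume_parabolicCylinder_ne_top R₂ z₁).lt_top
  set X : ℝ := K₀ * Ip.toReal ^ (1 / 2 : ℝ) with hX
  have hX0 : 0 ≤ X := by positivity
  -- ### the recursion `f(s) ≤ X (t-s)^{-5} f(t)^{1-p/2}` on `[R₂/2, R₂]`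
  have hrec : ∀ s t : ℝ, R₂ / 2 ≤ s → s < t → t ≤ R₂ → f s ≤ X / (t - s) ^ (5 : ℝ) * f t ^ (1 - p / 2) := by
    intro s t hs hst ht
    have hs0 : 0 < s := lt_of_lt_of_le (by positivity) hs
    have ht0 : 0 < t := hs0.trans hst
    have hts : 0 < t - s := sub_pos.2 hst
    have hgt : AEStronglyMeasurable g (volume.restrict (parabolicCylinder t z₁)) :=
      hg.mono_measure (Measure.restrict_mono (parabolicCylinder_subset_of_le ht0.le ht z₁) le_rfl)
    -- Moser's chain between `s` and `t`
    have hchain := eLpNorm_top_le_of_reverseHolder_parabolicCylinder (g := g) (z₁ := z₁)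
      (by linarith) hst hN₁ hgt
      (fun m hm ϱ ϱ' h1 h2 h3 => H m hm ϱ ϱ' (hs.trans h1) h2 (h3.trans ht))
    -- interpolation at radius `t`
    have hint := eLpNorm_two_le_top_rpow_mul_lintegral hgt hp0 hp2
    have hIt : ∫⁻ w in parabolicCylinder t z₁, ‖g w‖ₑ ^ p ≤ Ip :=
      lintegral_mono_set (parabolicCylinder_subset_of_le ht0.le ht z₁)
    -- the constant at radius `t` is at most `K₀`
    have hKt : (16 * N₁ ^ 2 * t ^ 2) ^ (5 / 4 : ℝ) * 16 ^ (15 / 8 : ℝ) ≤ K₀ := by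
      rw [hK₀]
      gcongr
    -- assemble in `ℝ≥0∞`
    have hM : M s ≤ ENNReal.ofReal (K₀ / (t - s) ^ 5) * (M t ^ (1 - p / 2) * Ip ^ (1 / 2 : ℝ)) := by
      calc M s ≤ ENNReal.ofReal ((16 * N₁ ^ 2 * t ^ 2) ^ (5 / 4 : ℝ) * 16 ^ (15 / 8 : ℝ) / (t - s) ^ 5) *
            eLpNorm g 2 (volume.restrict (parabolicCylinder t z₁)) := hchain
        _ ≤ ENNReal.ofReal (K₀ / (t - s) ^ 5) * (M t ^ (1 - p / 2) * Ip ^ (1 / 2 : ℝ)) := by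
            refine mul_le_mul' (ENNReal.ofReal_le_ofReal ?_) (hint.trans ?_)
            · exact div_le_div_of_nonneg_right hKt (by positivity)
            · exact mul_le_mul' le_rfl (ENNReal.rpow_le_rpow hIt (by norm_num))
    -- pass to real numbers
    have hMt_fin : M t ≠ ∞ := (hMfin t ht0.le ht).ne
    have hrhs_fin : ENNReal.ofReal (K₀ / (t - s) ^ 5) * (M t ^ (1 - p / 2) * Ip ^ (1 / 2 : ℝ)) ≠ ∞ :=
      ENNReal.mul_ne_top ENNReal.ofReal_ne_top (ENNReal.mul_ne_top
        (ENNReal.rpow_ne_top_of_nonneg (by linarith) hMt_fin)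
        (ENNReal.rpow_ne_top_of_nonneg (by norm_num) hIp_fin.ne))
    have hreal := ENNReal.toReal_mono hrhs_fin hM
    rw [ENNReal.toReal_mul, ENNReal.toReal_mul, ENNReal.toReal_ofReal (by positivity),
      ← ENNReal.toReal_rpow, ← ENNReal.toReal_rpow] at hreal
    calc f s = (M s).toReal := rfl
      _ ≤ K₀ / (t - s) ^ 5 * ((M t).toReal ^ (1 - p / 2) * Ip.toReal ^ (1 / 2 : ℝ)) := hreal
      _ = X / (t - s) ^ (5 : ℝ) * f t ^ (1 - p / 2) := by
          rw [hX, hfdef, show (t - s) ^ (5 : ℝ) = (t - s) ^ (5 : ℕ) by exact_mod_cast Real.rpow_natCast _ 5]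
          ring
  -- ### the absorption lemma
  have hf0 : ∀ s ∈ Icc (R₂ / 2) R₂, 0 ≤ f s := fun s _ => ENNReal.toReal_nonneg
  have hfL : ∀ s ∈ Icc (R₂ / 2) R₂, f s ≤ f R₂ := fun s hs =>
    ENNReal.toReal_mono hbdd.ne (hMmono s R₂ (by linarith [hs.1]) hs.2)
  have key := habs f (R₂ / 2) R₂ X (f R₂) (by linarith) hX0 hf0 hfL hrec
  -- ### reading off
  have hX2 : X ^ (2 / p) = K₀ ^ (2 / p) * Ip.toReal ^ (1 / p) := by
    rw [hX, Real.mul_rpow hK₀pos.le (by positivity), ← Real.rpow_mul ENNReal.toReal_nonneg]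
    congr 2; field_simp
  calc f (R₂ / 2) ≤ c * X ^ (2 / p) / (R₂ - R₂ / 2) ^ (2 * 5 / p) := key
    _ = c * K₀ ^ (2 / p) * Ip.toReal ^ (1 / p) / (R₂ / 2) ^ (10 / p) := by
        rw [hX2, show R₂ - R₂ / 2 = R₂ / 2 by ring, show (2 : ℝ) * 5 / p = 10 / p by ring]
        ring

end

end Summit.NavierStokesRegularity.NavierStokesRegularity.Theorems.SwirlFreeBudget
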